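import Literature.NumberTheory.Rogawski1990.ArchCentralLimitFormulaClosure          -- ★ p844012 FILE C (F0P3a-p02): `archCentralLimitFormulaRankTwo_of_compactPair01` (CM patterns (+,+,−) and (−,−,+))
import Literature.NumberTheory.Automorphic.ArchLocalDiagonalOppositeSignFrame       -- (G′-a) (this seat): the OPPOSITE-sign frame; brings ★ (G) `ArchLocalDiagonalSignFrame`
import Literature.NumberTheory.Automorphic.ArchLocalRegularOrbitClosed              -- ★ `locallyCompactSpace_archLocal`, `secondCountableTopology_archLocal`
import HarnessLib

/-!
# ROAD A, brick (G′): `ArchCentralLimitFormulaRankTwo` at a frame with the OPPOSITE sign pattern, and the closer's reduction to the single CM pattern `(+,+,−)`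
# (`U(−H) = U(H)`; Rogawski 1990 §8.4 p. 126 — the statement is about `U(2,1)`)

Topic `NumberTheory/Rogawski1990`; namespace `Literature.NumberTheory.Rogawski1990`.  THEOREMS ONLY (no `def`, no instance, no notation, no axiom, no named fact, no `sorry`).
Cell `pub/hodgecm-mathlib`, ENGINE T1 (crux H413 = `stmt-HodgeConjecture-24833`); ROAD A toward N1 = the registered stub `stub_L21` (closer) ∕ `stub_ArchCentralLimitU21` («SdArch»).
Sequel of ★ (G) `ArchCentralLimitFormulaOfSigns` (A-p18 (g25)) and ★ FILE C `ArchCentralLimitFormulaClosure` (F0P3a-p02 (g13)): FILE C's `archCentralLimitFormulaRankTwo_of_compactPair01`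
asks the letter at the CM sign patterns `(+,+,−)` AND `(−,−,+)`, while the D-chamber value `hDmin ⟸ cornerValue_min_of_ball` (F0P3a-p02 (g13), `h0 : 0 < re σα₀`, `h1 : 0 < re σα₁`,
`h2 : re σα₂ < 0`) is typed at `(+,+,−)` only.  This file closes the gap.  Author A-p18 (g26), 2026-09-01.

WHAT IS PROVED.
* §1 **`archCentralLimitFormulaRankTwo_of_frame`** — the ★ `…_of_signs` transport ABSTRACTED over the frame data: any `T : GL₃(ℂ)` and `e : G₀ ≃ₜ* G` with `e u = T u T⁻¹`, `e (t₀ z) = t z`,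
  `T diag(z) T⁻¹ = diag(z)` carry the letter from `(L₀, α₀, w₀)` to `(L, α, w)` (given the transfer of `α_i ≠ 0` and of indefiniteness).  Proof = the ★ (G) proof verbatim (Haar pulled back,
  `Θ ↦ Θ ∘ Ad T`, ★ `integral_comp_conj_eq_integral_map_symm_of_signs`, ★ `comp_conj_circleDiagonal_of_signs`).
* §2 **`archCentralLimitFormulaRankTwo_of_oppositeSigns`** — `re σ_wα_i · re σ_{w₀}α₀_i < 0` for all `i` ⟹ the letter transfers (§1 + (G′-a) `exists_continuousMulEquiv_archLocal_of_oppositeSigns`);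
  **`archCentralLimitFormulaRankTwo_neg_iff`**-style corollary `…_of_neg`: the letter at `(L, −α, w)` gives it at `(L, α, w)`.
* §3 **`archCentralLimitFormulaRankTwo_of_ppm`** — THE CLOSER'S REDUCTION: if the letter holds at every CM frame with `0 < re σα₀`, `0 < re σα₁`, `re σα₂ < 0`, it holds at EVERY frame
  `(L, α, w)` (★ FILE C + §2 at `α₀′ = −α₀` for the pattern `(−,−,+)`).  USE (closer ED.): `stub_L21 := archCentralLimitFormulaRankTwo_of_ppm (fun L₀ _ _ _ α₀ w₀ h0 h1 h2 =>
  of_cornerRegularity_of_wallValues_min (mul_neg_of_pos_of_neg h0 h2) (stub_A6 …) (cornerValue_min_of_ball L₀ α₀ w₀ h0 h1 h2 (W6 …)) (wall02_cubeLimit L₀ α₀ w₀ (mul_neg_of_pos_of_neg h0 h2)))`.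
HONEST LABEL: frame bookkeeping; HC_CM is proved only modulo the printed citations until rung 0 closes and this file pays nothing by itself.

## References
* [Rogawski1990] J. D. Rogawski, *Automorphic Representations of Unitary Groups in Three Variables*, Ann. of Math. Stud. 123 (1990), §8.4 pp. 126–127.
* [PlatonovRapinchuk1994] V. Platonov, A. Rapinchuk, *Algebraic Groups and Number Theory* (1994), §2.3.
-/

set_option autoImplicit false

noncomputable section

open MeasureTheory Measure Filter Topology NumberField NumberField.InfinitePlace Matrix
open Literature.NumberTheory.Automorphic Literature.NumberTheory.Automorphic.UnitaryGroup
open scoped Matrix.Norms.Operator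

namespace Literature.NumberTheory.Rogawski1990

section OfFrame

variable (L : Type) [Field L] (α : Fin 3 → L) (w : {w : InfinitePlace L // IsComplex w})
variable (L₀ : Type) [Field L₀] (α₀ : Fin 3 → L₀) (w₀ : {w : InfinitePlace L₀ // IsComplex w})

/-- **THE LETTER ALONG A TORUS-FIXING FRAME** (the ★ (G) transport abstracted over its frame data).  Given `T : GL₃(ℂ)` and `e : U(σ_{w₀} diag α₀)(ℂ) ≃ₜ* U(σ_w diag α)(ℂ)` with
`e u = T u T⁻¹`, `e (t₀ z) = t z` and `T diag(z) T⁻¹ = diag(z)`, the transfer of `α_i ≠ 0` and of indefiniteness to the source frame, and `σ_{w₀}α₀_i` real: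
`ArchCentralLimitFormulaRankTwo L₀ α₀ w₀ → ArchCentralLimitFormulaRankTwo L α w`. [cite: Rogawski1990, §8.4 pp. 126–127] [cite: PlatonovRapinchuk1994, §2.3] -/
theorem archCentralLimitFormulaRankTwo_of_frame (hreal₀ : ∀ i, (w₀.1.embedding (α₀ i)).im = 0)
    (hα₀ : (∀ i, α i ≠ 0) → ∀ i, α₀ i ≠ 0)
    (hind₀ : (∃ i j : Fin 3, (w.1.embedding (α i)).re * (w.1.embedding (α j)).re < 0) → ∃ i j : Fin 3, (w₀.1.embedding (α₀ i)).re * (w₀.1.embedding (α₀ j)).re < 0)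
    (T : GL (Fin 3) ℂ) (e : archLocal L₀ 3 (Matrix.diagonal α₀) w₀ ≃ₜ* archLocal L 3 (Matrix.diagonal α) w)
    (he : ∀ u : archLocal L₀ 3 (Matrix.diagonal α₀) w₀, ((e u : archLocal L 3 (Matrix.diagonal α) w) : GL (Fin 3) ℂ) = T * (u : GL (Fin 3) ℂ) * T⁻¹)
    (hez : ∀ z : Fin 3 → Circle, e ⟨circleDiagonal 3 z, circleDiagonal_mem_archLocal_diagonal L₀ 3 α₀ w₀ z⟩ = ⟨circleDiagonal 3 z, circleDiagonal_mem_archLocal_diagonal L 3 α w z⟩)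
    (hTz : ∀ z : Fin 3 → Circle, (T : Matrix (Fin 3) (Fin 3) ℂ) * Matrix.diagonal (fun i => (z i : ℂ)) * ((T⁻¹ : GL (Fin 3) ℂ) : Matrix (Fin 3) (Fin 3) ℂ) = Matrix.diagonal (fun i => (z i : ℂ)))
    (h₀ : ArchCentralLimitFormulaRankTwo L₀ α₀ w₀) : ArchCentralLimitFormulaRankTwo L α w := by
  intro _ _ _ _ hα hreal' hind ν _ _
  -- topology and Borel structure on the source frame `G₀`
  haveI : LocallyCompactSpace (archLocal L₀ 3 (Matrix.diagonal α₀) w₀) := locallyCompactSpace_archLocal L₀ 3 (Matrix.diagonal α₀) w₀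
  haveI : SecondCountableTopology (archLocal L₀ 3 (Matrix.diagonal α₀) w₀) := secondCountableTopology_archLocal L₀ 3 (Matrix.diagonal α₀) w₀
  letI : MeasurableSpace (archLocal L₀ 3 (Matrix.diagonal α₀) w₀) := borel _
  haveI : BorelSpace (archLocal L₀ 3 (Matrix.diagonal α₀) w₀) := ⟨rfl⟩
  -- the pulled-back Haar measure
  haveI := isHaarMeasure_map_symm_of_signs L α w L₀ α₀ w₀ e ν
  haveI := isMulRightInvariant_map_symm_of_signs L α w L₀ α₀ w₀ e ν
  obtain ⟨c, hc, hmain⟩ := h₀ (hα₀ hα) hreal₀ (hind₀ hind) (ν.map e.symm)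
  refine ⟨c, hc, fun Θ hΘ hsupp ζ => ?_⟩
  -- the letter at `(G₀, ν.map e⁻¹, Θ ∘ Ad T, ζ)`
  have key := hmain (fun M : Matrix (Fin 3) (Fin 3) ℂ => Θ ((T : Matrix (Fin 3) (Fin 3) ℂ) * M * ((T⁻¹ : GL (Fin 3) ℂ) : Matrix (Fin 3) (Fin 3) ℂ)))
    (hΘ.comp ((contDiff_const.mul contDiff_id).mul contDiff_const))
    (hasCompactSupport_comp_conj_of_signs L α w L₀ α₀ w₀ T e he hsupp) ζ
  have hΦ : ∀ r : Fin 3 → Circle,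
      ∫ u, Θ ((T : Matrix (Fin 3) (Fin 3) ℂ) *
          (((u * ⟨circleDiagonal 3 r, circleDiagonal_mem_archLocal_diagonal L₀ 3 α₀ w₀ r⟩ * u⁻¹ : archLocal L₀ 3 (Matrix.diagonal α₀) w₀) : GL (Fin 3) ℂ) : Matrix (Fin 3) (Fin 3) ℂ) *
          ((T⁻¹ : GL (Fin 3) ℂ) : Matrix (Fin 3) (Fin 3) ℂ)) ∂(ν.map e.symm) =
        ∫ g, Θ (((g * ⟨circleDiagonal 3 r, circleDiagonal_mem_archLocal_diagonal L 3 α w r⟩ * g⁻¹ : archLocal L 3 (Matrix.diagonal α) w) : GL (Fin 3) ℂ) : Matrix (Fin 3) (Fin 3) ℂ) ∂ν :=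
    fun r => (integral_comp_conj_eq_integral_map_symm_of_signs L α w L₀ α₀ w₀ T e he hez ν Θ r).symm
  have hcen := comp_conj_circleDiagonal_of_signs (E := ℂ) T hTz Θ (fun _ : Fin 3 => ζ)
  simp only [hΦ, hcen] at key
  exact key

end OfFrame

section OfOppositeSigns

variable (L : Type) [Field L] (α : Fin 3 → L) (w : {w : InfinitePlace L // IsComplex w})
variable (L₀ : Type) [Field L₀] (α₀ : Fin 3 → L₀) (w₀ : {w : InfinitePlace L₀ // IsComplex w})

/-- **(G′) THE LETTER TRANSFERS BETWEEN FRAMES OF OPPOSITE SIGN PATTERNS**: if `σ_w(α_i)`, `σ_{w₀}(α₀_i)` are real with `re σ_w(α_i) · re σ_{w₀}(α₀_i) < 0` for every `i` (so that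
`U(σ_w diag α) ≅ U(−σ_{w₀} diag α₀) = U(σ_{w₀} diag α₀)`), then `ArchCentralLimitFormulaRankTwo L₀ α₀ w₀ → ArchCentralLimitFormulaRankTwo L α w` (§1 + (G′-a)).
[cite: Rogawski1990, §8.4 pp. 126–127] [cite: PlatonovRapinchuk1994, §2.3] -/
theorem archCentralLimitFormulaRankTwo_of_oppositeSigns (hreal : ∀ i, (w.1.embedding (α i)).im = 0) (hreal₀ : ∀ i, (w₀.1.embedding (α₀ i)).im = 0)
    (hopp : ∀ i, (w.1.embedding (α i)).re * (w₀.1.embedding (α₀ i)).re < 0)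
    (h₀ : ArchCentralLimitFormulaRankTwo L₀ α₀ w₀) : ArchCentralLimitFormulaRankTwo L α w := by
  obtain ⟨T, e, he, hez, hTz⟩ := exists_continuousMulEquiv_archLocal_of_oppositeSigns L α w L₀ α₀ w₀ hreal hreal₀ hopp
  exact archCentralLimitFormulaRankTwo_of_frame L α w L₀ α₀ w₀ hreal₀ (fun _ => ne_zero_of_oppositeSigns L α w L₀ α₀ w₀ hopp)
    (exists_mul_re_neg_of_oppositeSigns L α w L₀ α₀ w₀ hopp) T e he hez hTz h₀

/-- **The letter is insensitive to the global sign of the form**: `ArchCentralLimitFormulaRankTwo L (−α) w → ArchCentralLimitFormulaRankTwo L α w` (for `σ_wα_i` real nonzero).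
[cite: Rogawski1990, §8.4 pp. 126–127] -/
theorem archCentralLimitFormulaRankTwo_of_neg (hreal : ∀ i, (w.1.embedding (α i)).im = 0) (hne : ∀ i, (w.1.embedding (α i)).re ≠ 0)
    (h₀ : ArchCentralLimitFormulaRankTwo L (fun i => -α i) w) : ArchCentralLimitFormulaRankTwo L α w := by
  refine archCentralLimitFormulaRankTwo_of_oppositeSigns L α w L (fun i => -α i) w hreal (fun i => ?_) (fun i => ?_) h₀
  · rw [map_neg, Complex.neg_im, hreal i, neg_zero]
  · rw [map_neg, Complex.neg_re]
    nlinarith [sq_pos_of_ne_zero (hne i)]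

end OfOppositeSigns

section Closure

/-- **THE CLOSER'S REDUCTION TO THE SINGLE CM SIGN PATTERN `(+,+,−)`.**  If `ArchCentralLimitFormulaRankTwo L₀ α₀ w₀` holds for every CM field `L₀`, complex place `w₀` and `α₀` with
`0 < re σ_{w₀}α₀₀`, `0 < re σ_{w₀}α₀₁`, `re σ_{w₀}α₀₂ < 0`, then it holds for EVERY field `L` with a complex place and every `α` (★ FILE C `…_of_compactPair01` + `…_of_neg` for the
pattern `(−,−,+)`).  This is the shape the «L21 ⟸ A6» closer edition consumes: `hDmin ⟸ cornerValue_min_of_ball h0 h1 h2`, `hS := wall02_cubeLimit … (mul_neg_of_pos_of_neg h0 h2)`.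
[cite: Rogawski1990, §8.4 pp. 126–127] -/
theorem archCentralLimitFormulaRankTwo_of_ppm
    (h : ∀ (L₀ : Type) [Field L₀] [NumberField L₀] [IsCMField L₀] (α₀ : Fin 3 → L₀) (w₀ : {w : InfinitePlace L₀ // IsComplex w}),
      0 < (w₀.1.embedding (α₀ 0)).re → 0 < (w₀.1.embedding (α₀ 1)).re → (w₀.1.embedding (α₀ 2)).re < 0 →
      ArchCentralLimitFormulaRankTwo L₀ α₀ w₀)
    (L : Type) [Field L] (α : Fin 3 → L) (w : {w : InfinitePlace L // IsComplex w}) : ArchCentralLimitFormulaRankTwo L α w := by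
  refine archCentralLimitFormulaRankTwo_of_compactPair01 (fun L₀ _ _ _ α₀ w₀ h01 h02 => ?_) L α w
  -- the letter's own binders (the reality of `σα₀` is among them)
  intro _ _ _ _ hα hreal hind ν _ _
  -- either `(+,+,−)` — the hypothesis — or `(−,−,+)` — the hypothesis at `−α₀`, transported by `…_of_neg`
  rcases lt_or_gt_of_ne (show (w₀.1.embedding (α₀ 0)).re ≠ 0 from fun h0 => by rw [h0, zero_mul] at h01; exact lt_irrefl _ h01) with hneg | hpos
  · have h1 : (w₀.1.embedding (α₀ 1)).re < 0 := by nlinarith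
    have h2 : 0 < (w₀.1.embedding (α₀ 2)).re := by nlinarith
    have hne : ∀ i, (w₀.1.embedding (α₀ i)).re ≠ 0 := fun i => match i with
      | 0 => hneg.ne | 1 => h1.ne | 2 => h2.ne'
    exact archCentralLimitFormulaRankTwo_of_neg L₀ α₀ w₀ hreal hne
      (h L₀ (fun i => -α₀ i) w₀ (by rw [map_neg, Complex.neg_re]; linarith) (by rw [map_neg, Complex.neg_re]; linarith) (by rw [map_neg, Complex.neg_re]; linarith))
      hα hreal hind ν
  · have h1 : 0 < (w₀.1.embedding (α₀ 1)).re := by nlinarith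
    have h2 : (w₀.1.embedding (α₀ 2)).re < 0 := by nlinarith
    exact h L₀ α₀ w₀ hpos h1 h2 hα hreal hind ν

end Closure

end Literature.NumberTheory.Rogawski1990

end
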